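import Literature.AlgebraicGeometry.AbelianSchemes.AbelianSchemeFibreFieldChange
import Mathlib.FieldTheory.IsAlgClosed.AlgebraicClosure
import Mathlib.RingTheory.TensorProduct.Nontrivial
import HarnessLib

/-!
# The `Pic⁰` locus of a rigidified line bundle, and «the `Pic⁰` condition spreads along a dominant map» (Mumford §8, §10; Milne I §8)

Layer `Literature/AlgebraicGeometry/AbelianSchemes`, namespace `Literature.AlgebraicGeometry.AbelianSchemes.AbelianSchemeOver.RigidifiedLineBundle`.
Definitions with bodies (`picZeroLocus`, the module isomorphism `fibreModuleFieldChangeIso`, and three named predicates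
`GeomPointIndependent`, `FieldChangeInvariant`, `GeomPointsAmalgamate` — vocabulary, each proved or reduced below) and theorems;
no named fact, no instance, no `sorry`.

Setting ([MumfordAV1970] §8, §10; [MilneAV2008] I §8): an abelian scheme `A/S`, `f : T ⟶ S`, a rigidified line bundle `ℒ` on `A_T`
(★ `AbelianSchemeOver.RigidifiedLineBundle`), its fibre modules `ℒ.fibreModule t` at geometric points `t : Spec Ω → T` and the
predicate ★ `FibrewisePicZero` («`ℒ_t ∈ Pic⁰(A_t)` for every geometric point», as ★ `IsHomogeneous`).

* §1 `picZeroLocus ℒ ⊆ T` — the scheme points `x` such that `ℒ` is homogeneous at EVERY geometric point over `x`;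
  `fibrewisePicZero_iff_forall_mem_picZeroLocus`, `FibrewisePicZero.of_picZeroLocus_eq_univ`.
* §2 `GeomPointIndependent ℒ` (homogeneity at one geometric point over `x` gives it at all), `exists_geomPoint_over`,
  `fibreModuleFieldChangeIso`, `isHomogeneous_fibre_iff_of_ascent_descent` (through `fibreFieldChangeIso`),
  `FieldChangeInvariant ℒ` and `fieldChangeInvariant_of_ascent_descent` (reduction to ascent + descent of homogeneity of rank-one
  modules along maps of algebraically closed fields), `GeomPointsAmalgamate T` with **`geomPointsAmalgamate`** PROVED (two geometric
  points over one scheme point agree after a common extension, `Ω ⊗_{κ(x)} Ω′ ↠ Ω″`), `geomPointIndependent_of(_fieldChangeInvariant)`.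
* §3 **`FibrewisePicZero.of_denseRange`** — if `w : T₁ → T` has dense image, `ℒ` is homogeneous at every geometric point factoring
  through `w`, the locus is closed and geometric points are independent, then `ℒ.FibrewisePicZero` («closed + dense ⇒ all»);
  variants `…_of_range_subset`, `…'` (on `FieldChangeInvariant`), `…''` (on ascent + descent).
* (dominance of `Spec B → Spec A` for an injective `A → B`, used with §3 by the limit descent, is ★
  `Limits.denseRange_specMap_of_injective` of `Limits/RankOnePullbackDense`.)

The two remaining inputs — ascent/descent of homogeneity (★ `AbelianVarieties/HomogeneousLineBundleFieldChange`) and the closedness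
of the locus (★ `AbelianVarieties/RigidifiedLineBundlePicZeroLocusClosed`) — are supplied in
★ `AbelianVarieties/RigidifiedLineBundleFibrewisePicZeroOfDense`.  Cell `hodgecm-mathlib`, road M13 N0 (0d-2), B-p21 (g12) lineage.
HC_CM is proved only modulo the 7 printed citations until rung 0 closes.

## References
* [MumfordAV1970] D. Mumford, *Abelian Varieties* (1970), §8 ((iv) ⇔ (i)), §10 (seesaw, p. 89).
* [MilneAV2008] J. S. Milne, *Abelian Varieties* (v2.00, 2008), I §8 pp. 36–37.
* [StacksProject] The Stacks Project, Tag 01ZR (limits of schemes).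
-/

universe u

open CategoryTheory CategoryTheory.Limits AlgebraicGeometry
open scoped TensorProduct

noncomputable section

-- `Scheme.Modules` / `SheafOfModules` are not reducible (as in Mathlib's `AlgebraicGeometry/Modules/Sheaf.lean`).
set_option backward.isDefEq.respectTransparency false

namespace Literature.AlgebraicGeometry.AbelianSchemes

open Literature.AlgebraicGeometry.Motives Literature.AlgebraicGeometry.AbelianVarieties
  Literature.AlgebraicGeometry.Modules Literature.AlgebraicGeometry.Limits

namespace AbelianSchemeOver

namespace RigidifiedLineBundle

variable {S T : Scheme.{u}} {A : AbelianSchemeOver S} {f : T ⟶ S} (ℒ : A.RigidifiedLineBundle f)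

/-! ### §1 The `Pic⁰` locus of a rigidified line bundle -/

/-- **the `Pic⁰` locus of `ℒ` in `T`**: the scheme points `x ∈ T` such that `ℒ_t ∈ Pic⁰(A_t)` (★ `IsHomogeneous`) at EVERY
geometric point `t : Spec Ω → T` lying over `x`. [cite: MumfordAV1970, §8 ((iv) ⇔ (i))] [cite: MilneAV2008, I §8 pp. 36–37] -/
def picZeroLocus : Set T :=
  {x | ∀ (Ω : Type u) [Field Ω] [IsAlgClosed Ω] (t : Spec (.of Ω) ⟶ T),
    t.base (IsLocalRing.closedPoint Ω) = x → IsHomogeneous ((A.baseChange f).fibre t).toAbelianVariety (ℒ.fibreModule t)}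

/-- membership, unfolded. [cite: MumfordAV1970, §8 ((iv) ⇔ (i))] -/
theorem mem_picZeroLocus_iff (x : T) :
    x ∈ ℒ.picZeroLocus ↔ ∀ (Ω : Type u) [Field Ω] [IsAlgClosed Ω] (t : Spec (.of Ω) ⟶ T),
      t.base (IsLocalRing.closedPoint Ω) = x →
        IsHomogeneous ((A.baseChange f).fibre t).toAbelianVariety (ℒ.fibreModule t) :=
  Iff.rfl

/-- **`ℒ` is fibrewise-`Pic⁰` iff its `Pic⁰` locus is all of `T`** (every geometric point lies over its image point).
[cite: MumfordAV1970, §8 ((iv) ⇔ (i))] [cite: MilneAV2008, I §8 pp. 36–37] -/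
theorem fibrewisePicZero_iff_forall_mem_picZeroLocus : ℒ.FibrewisePicZero ↔ ∀ x : T, x ∈ ℒ.picZeroLocus := by
  constructor
  · intro h x Ω _ _ t _
    exact h Ω t
  · intro h Ω _ _ t
    exact h _ Ω t rfl

/-- `picZeroLocus ℒ = univ ⇒ ℒ` fibrewise-`Pic⁰`. [cite: MumfordAV1970, §8 ((iv) ⇔ (i))] -/
theorem FibrewisePicZero.of_picZeroLocus_eq_univ (h : ℒ.picZeroLocus = Set.univ) : ℒ.FibrewisePicZero :=
  ℒ.fibrewisePicZero_iff_forall_mem_picZeroLocus.2 fun x => h ▸ Set.mem_univ x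

/-- `ℒ` fibrewise-`Pic⁰` `⇒ picZeroLocus ℒ = univ`. [cite: MumfordAV1970, §8 ((iv) ⇔ (i))] -/
theorem FibrewisePicZero.picZeroLocus_eq_univ (h : ℒ.FibrewisePicZero) : ℒ.picZeroLocus = Set.univ :=
  Set.eq_univ_of_forall (ℒ.fibrewisePicZero_iff_forall_mem_picZeroLocus.1 h)

/-! ### §2 Geometric points over a scheme point; independence of the geometric point -/

/-- **every scheme point carries a geometric point**: `Spec κ(x)^{alg} → Spec κ(x) → T` hits `x`. [cite: StacksProject, Tag 01ZR] -/
theorem exists_geomPoint_over (x : T) :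
    ∃ t : Spec (.of (AlgebraicClosure (T.residueField x))) ⟶ T,
      t.base (IsLocalRing.closedPoint (AlgebraicClosure (T.residueField x))) = x := by
  refine ⟨Spec.map (CommRingCat.ofHom (algebraMap (T.residueField x) (AlgebraicClosure (T.residueField x)))) ≫
    T.fromSpecResidueField x, ?_⟩
  show (T.fromSpecResidueField x).base ((Spec.map (CommRingCat.ofHom
    (algebraMap (T.residueField x) (AlgebraicClosure (T.residueField x))))).base _) = x
  exact Scheme.fromSpecResidueField_apply (X := T) x _

/-- **Independence of the geometric point** (a named predicate, proved in `geomPointIndependent_of_fieldChangeInvariant`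
below from field-change invariance): homogeneity of `ℒ` at one geometric point over a scheme point `x` implies homogeneity at
every geometric point over `x` — two geometric points over `x` factor through `Spec κ(x)` and amalgamate in a common
algebraically closed field, along which homogeneity ascends and descends ([MumfordAV1970] §8: `Pic⁰` is a geometric
condition). [cite: MumfordAV1970, §8 ((iv) ⇔ (i))] -/
def GeomPointIndependent (ℒ : A.RigidifiedLineBundle f) : Prop :=
  ∀ (Ω : Type u) [Field Ω] [IsAlgClosed Ω] (Ω' : Type u) [Field Ω'] [IsAlgClosed Ω']
    (t : Spec (.of Ω) ⟶ T) (t' : Spec (.of Ω') ⟶ T),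
    t.base (IsLocalRing.closedPoint Ω) = t'.base (IsLocalRing.closedPoint Ω') →
      IsHomogeneous ((A.baseChange f).fibre t).toAbelianVariety (ℒ.fibreModule t) →
        IsHomogeneous ((A.baseChange f).fibre t').toAbelianVariety (ℒ.fibreModule t')

/-- **one homogeneous geometric point over `x` puts `x` in the `Pic⁰` locus** (under independence of the geometric point).
[cite: MumfordAV1970, §8 ((iv) ⇔ (i))] -/
theorem mem_picZeroLocus_of_isHomogeneous (hind : ℒ.GeomPointIndependent) {Ω : Type u} [Field Ω] [IsAlgClosed Ω]
    (t : Spec (.of Ω) ⟶ T) (h : IsHomogeneous ((A.baseChange f).fibre t).toAbelianVariety (ℒ.fibreModule t)) :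
    t.base (IsLocalRing.closedPoint Ω) ∈ ℒ.picZeroLocus :=
  fun Ω' _ _ t' ht' => hind Ω Ω' t t' ht'.symm h

/-- **the fibre modules correspond under the field-change isomorphism**: `e^*(ℒ_{Spec φ ≫ t}) ≅ pr^*(ℒ_t)` on
`(A_T)_t ⊗_Ω Ω″` (both are pull-backs of `ℒ` along the same map to `A_T`). [cite: MilneAV2008, I §8 pp. 36–37] -/
def fibreModuleFieldChangeIso {Ω Ω'' : Type u} [Field Ω] [Field Ω''] (φ : Ω →+* Ω'') (t : Spec (.of Ω) ⟶ T) :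
    (Scheme.Modules.pullback (AbelianVariety.Hom.toSchemeHom ((A.baseChange f).fibreFieldChangeIso φ t).hom)).obj
        (ℒ.fibreModule (specAlong φ ≫ t)) ≅
      (Scheme.Modules.pullback (pullback.fst (((A.baseChange f).fibre t).toAbelianVariety.X.hom) (specAlong φ))).obj
        (ℒ.fibreModule t) :=
  (Scheme.Modules.pullbackComp _ _).app ℒ.L ≪≫
    (Scheme.Modules.pullbackCongr ((A.baseChange f).fibreFieldChangeIso_hom_toSchemeHom_fst φ t)).app ℒ.L ≪≫
    ((Scheme.Modules.pullbackComp _ _).app ℒ.L).symm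

/-- **field-change invariance of fibrewise homogeneity from ASCENT + DESCENT of homogeneity of rank-one modules along
extensions of algebraically closed fields** (both supplied by ★ `AbelianVarieties/HomogeneousLineBundleFieldChange`): `ℒ` is
homogeneous at `t` iff at `Spec φ ≫ t`. [cite: MumfordAV1970, §8 ((iv) ⇔ (i))] -/
theorem isHomogeneous_fibre_iff_of_ascent_descent
    (hasc : ∀ (Ω₁ : Type u) [Field Ω₁] [IsAlgClosed Ω₁] (Ω₂ : Type u) [Field Ω₂] [IsAlgClosed Ω₂] (ψ : Ω₁ →+* Ω₂)
      (C : AbelianVariety Ω₁) (E : C.X.left.Modules), HasRank E 1 → IsHomogeneous C E →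
        IsHomogeneous (C.baseChangeAlong ψ)
          ((Scheme.Modules.pullback (pullback.fst C.X.hom (Spec.map (CommRingCat.ofHom ψ)))).obj E))
    (hdesc : ∀ (Ω₁ : Type u) [Field Ω₁] [IsAlgClosed Ω₁] (Ω₂ : Type u) [Field Ω₂] [IsAlgClosed Ω₂] (ψ : Ω₁ →+* Ω₂)
      (C : AbelianVariety Ω₁) (E : C.X.left.Modules), HasRank E 1 →
        IsHomogeneous (C.baseChangeAlong ψ)
          ((Scheme.Modules.pullback (pullback.fst C.X.hom (Spec.map (CommRingCat.ofHom ψ)))).obj E) → IsHomogeneous C E)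
    {Ω Ω'' : Type u} [Field Ω] [IsAlgClosed Ω] [Field Ω''] [IsAlgClosed Ω''] (φ : Ω →+* Ω'') (t : Spec (.of Ω) ⟶ T) :
    IsHomogeneous ((A.baseChange f).fibre t).toAbelianVariety (ℒ.fibreModule t) ↔
      IsHomogeneous ((A.baseChange f).fibre (Spec.map (CommRingCat.ofHom φ) ≫ t)).toAbelianVariety
        (ℒ.fibreModule (Spec.map (CommRingCat.ofHom φ) ≫ t)) := by
  have hE : HasRank (ℒ.fibreModule t) 1 := hasRank_pullback _ ℒ.hasRank_one
  have e := (A.baseChange f).fibreFieldChangeIso φ t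
  constructor
  · intro h
    have h1 := hasc Ω Ω'' φ _ _ hE h
    have h2 := (isHomogeneous_iff_of_iso _ (ℒ.fibreModuleFieldChangeIso φ t)).2 h1
    exact (isHomogeneous_pullback_iff_of_iso ((A.baseChange f).fibreFieldChangeIso φ t) _).1 h2
  · intro h
    have h2 := (isHomogeneous_pullback_iff_of_iso ((A.baseChange f).fibreFieldChangeIso φ t) _).2 h
    have h1 := (isHomogeneous_iff_of_iso _ (ℒ.fibreModuleFieldChangeIso φ t)).1 h2
    exact hdesc Ω Ω'' φ _ _ hE h1

/-- **Field change at a geometric point** (a named predicate, reduced to ascent + descent in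
`fieldChangeInvariant_of_ascent_descent`): for a geometric point `t : Spec Ω → T` and an extension `φ₁ : Ω → Ω″` of
algebraically closed fields, `ℒ` is homogeneous at `t` iff it is homogeneous at the geometric point `Spec φ₁ ≫ t` — the fibre
at `Spec φ₁ ≫ t` is the base change `(A_T)_t ×_Ω Ω″` (`fibreFieldChangeIso`) and the fibre modules correspond
(`fibreModuleFieldChangeIso`). [cite: MumfordAV1970, §8 ((iv) ⇔ (i))] -/
def FieldChangeInvariant (ℒ : A.RigidifiedLineBundle f) : Prop :=
  ∀ (Ω : Type u) [Field Ω] [IsAlgClosed Ω] (Ω'' : Type u) [Field Ω''] [IsAlgClosed Ω''] (φ₁ : Ω →+* Ω'')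
    (t : Spec (.of Ω) ⟶ T),
    IsHomogeneous ((A.baseChange f).fibre t).toAbelianVariety (ℒ.fibreModule t) ↔
      IsHomogeneous ((A.baseChange f).fibre (Spec.map (CommRingCat.ofHom φ₁) ≫ t)).toAbelianVariety
        (ℒ.fibreModule (Spec.map (CommRingCat.ofHom φ₁) ≫ t))

/-- **Field-change invariance from ASCENT + DESCENT** of homogeneity of rank-one modules along extensions of algebraically
closed fields (generic `AbelianVariety` statements, ★ `AbelianVarieties/HomogeneousLineBundleFieldChange`).
[cite: MumfordAV1970, §8 ((iv) ⇔ (i))] -/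
theorem fieldChangeInvariant_of_ascent_descent
    (hasc : ∀ (Ω₁ : Type u) [Field Ω₁] [IsAlgClosed Ω₁] (Ω₂ : Type u) [Field Ω₂] [IsAlgClosed Ω₂] (ψ : Ω₁ →+* Ω₂)
      (C : AbelianVariety Ω₁) (E : C.X.left.Modules), HasRank E 1 → IsHomogeneous C E →
        IsHomogeneous (C.baseChangeAlong ψ)
          ((Scheme.Modules.pullback (pullback.fst C.X.hom (Spec.map (CommRingCat.ofHom ψ)))).obj E))
    (hdesc : ∀ (Ω₁ : Type u) [Field Ω₁] [IsAlgClosed Ω₁] (Ω₂ : Type u) [Field Ω₂] [IsAlgClosed Ω₂] (ψ : Ω₁ →+* Ω₂)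
      (C : AbelianVariety Ω₁) (E : C.X.left.Modules), HasRank E 1 →
        IsHomogeneous (C.baseChangeAlong ψ)
          ((Scheme.Modules.pullback (pullback.fst C.X.hom (Spec.map (CommRingCat.ofHom ψ)))).obj E) → IsHomogeneous C E) :
    ℒ.FieldChangeInvariant :=
  fun _ _ _ _ _ _ φ t => ℒ.isHomogeneous_fibre_iff_of_ascent_descent hasc hdesc φ t

/-- **Amalgamation of two geometric points over one scheme point** (a named predicate, proved in `geomPointsAmalgamate`):
two geometric points over the same `x ∈ T` become EQUAL after extending both fields into a common algebraically closed field
(`Ω ⊗_{κ(x)} Ω′ ↠ K″ ⊆ K″^{alg}`). [cite: StacksProject, Tag 01ZR] -/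
def GeomPointsAmalgamate (T : Scheme.{u}) : Prop :=
  ∀ (Ω : Type u) [Field Ω] [IsAlgClosed Ω] (Ω' : Type u) [Field Ω'] [IsAlgClosed Ω']
    (t : Spec (.of Ω) ⟶ T) (t' : Spec (.of Ω') ⟶ T),
    t.base (IsLocalRing.closedPoint Ω) = t'.base (IsLocalRing.closedPoint Ω') →
      ∃ (Ω'' : Type u) (_ : Field Ω'') (_ : IsAlgClosed Ω'') (φ₁ : Ω →+* Ω'') (φ₂ : Ω' →+* Ω''),
        Spec.map (CommRingCat.ofHom φ₁) ≫ t = Spec.map (CommRingCat.ofHom φ₂) ≫ t'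

/-- **Two geometric points over one scheme point amalgamate**: `t = Spec φ ≫ (Spec κ(x) → T)`,
`t′ = Spec φ′ ≫ (Spec κ(x) → T)` (Mathlib `Scheme.descResidueField_stalkClosedPointTo_fromSpecResidueField`, the second moved to
`κ(x)` by `Scheme.residueFieldCongr`); `Ω ⊗_{κ(x)} Ω′ ≠ 0` (Mathlib `Algebra.TensorProduct.nontrivial_of_algebraMap_injective_of_isDomain`),
so it has a maximal ideal `𝔪`; `Ω″ := ((Ω ⊗ Ω′)/𝔪)^{alg}`; the two composites `κ(x) → Ω → Ω″`, `κ(x) → Ω′ → Ω″` agree because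
`φ(a) ⊗ 1 = 1 ⊗ φ′(a)` (both are `a · (1 ⊗ 1)`), whence the two morphisms `Spec Ω″ → T` agree. [cite: StacksProject, Tag 01ZR] -/
theorem geomPointsAmalgamate (T : Scheme.{u}) : GeomPointsAmalgamate T := by
  intro Ω _ _ Ω' _ _ t t' hx
  -- the two residue-field embeddings at `x := t(pt)`
  have ht : Spec.map (T.descResidueField (Scheme.stalkClosedPointTo t)) ≫ T.fromSpecResidueField _ = t :=
    Scheme.descResidueField_stalkClosedPointTo_fromSpecResidueField Ω T t
  have ht' : Spec.map (T.descResidueField (Scheme.stalkClosedPointTo t')) ≫ T.fromSpecResidueField _ = t' :=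
    Scheme.descResidueField_stalkClosedPointTo_fromSpecResidueField Ω' T t'
  -- move `t'`'s embedding to the residue field at `x`
  set x : T := t.base (IsLocalRing.closedPoint Ω) with hxdef
  set φ : T.residueField x ⟶ CommRingCat.of Ω := T.descResidueField (Scheme.stalkClosedPointTo t) with hφ
  set φ' : T.residueField x ⟶ CommRingCat.of Ω' :=
    (T.residueFieldCongr hx).hom ≫ T.descResidueField (Scheme.stalkClosedPointTo t') with hφ'
  have ht'x : Spec.map φ' ≫ T.fromSpecResidueField x = t' := by
    rw [hφ', Spec.map_comp, Category.assoc, Scheme.residueFieldCongr_fromSpecResidueField]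
    exact ht'
  -- `Ω`, `Ω'` as `κ(x)`-algebras; a common algebraically closed over-field
  letI algΩ : Algebra (T.residueField x) Ω := φ.hom.toAlgebra
  letI algΩ' : Algebra (T.residueField x) Ω' := φ'.hom.toAlgebra
  haveI : Nontrivial (Ω ⊗[T.residueField x] Ω') :=
    Algebra.TensorProduct.nontrivial_of_algebraMap_injective_of_isDomain (T.residueField x) Ω Ω'
      (algebraMap (T.residueField x) Ω).injective (algebraMap (T.residueField x) Ω').injective
  obtain ⟨𝔪, h𝔪⟩ := Ideal.exists_maximal (Ω ⊗[T.residueField x] Ω')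
  letI : Field ((Ω ⊗[T.residueField x] Ω') ⧸ 𝔪) := Ideal.Quotient.field 𝔪
  let K'' : Type u := (Ω ⊗[T.residueField x] Ω') ⧸ 𝔪
  let Ωc : Type u := AlgebraicClosure K''
  let q : Ω ⊗[T.residueField x] Ω' →+* Ωc := (algebraMap K'' Ωc).comp (Ideal.Quotient.mk 𝔪)
  let φ₁ : Ω →+* Ωc := q.comp Algebra.TensorProduct.includeLeftRingHom
  let φ₂ : Ω' →+* Ωc :=
    q.comp (Algebra.TensorProduct.includeRight : Ω' →ₐ[T.residueField x] Ω ⊗[T.residueField x] Ω').toRingHom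
  -- the two composites agree on `κ(x)`: `φ(a) ⊗ 1 = 1 ⊗ φ'(a)` in `Ω ⊗_{κ(x)} Ω'`
  have e : ∀ a : T.residueField x,
      φ.hom a ⊗ₜ[T.residueField x] (1 : Ω') = (1 : Ω) ⊗ₜ[T.residueField x] φ'.hom a := fun a => by
    have h1 : φ.hom a ⊗ₜ[T.residueField x] (1 : Ω') = algebraMap (T.residueField x) (Ω ⊗[T.residueField x] Ω') a :=
      (Algebra.TensorProduct.algebraMap_apply (R := T.residueField x) (A := Ω) (B := Ω') a).symm
    have h2 : (1 : Ω) ⊗ₜ[T.residueField x] φ'.hom a = algebraMap (T.residueField x) (Ω ⊗[T.residueField x] Ω') a :=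
      (Algebra.TensorProduct.algebraMap_apply' (R := T.residueField x) (A := Ω) (B := Ω') a).symm
    rw [h1, h2]
  have hk : φ₁.comp φ.hom = φ₂.comp φ'.hom :=
    RingHom.ext fun a => congrArg (fun z => q z) (e a)
  have hk' : φ ≫ CommRingCat.ofHom φ₁ = φ' ≫ CommRingCat.ofHom φ₂ := by
    ext1
    exact hk
  refine ⟨Ωc, inferInstance, inferInstance, φ₁, φ₂, ?_⟩
  calc Spec.map (CommRingCat.ofHom φ₁) ≫ t
      = Spec.map (CommRingCat.ofHom φ₁) ≫ (Spec.map φ ≫ T.fromSpecResidueField x) := by rw [ht]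
    _ = Spec.map (φ ≫ CommRingCat.ofHom φ₁) ≫ T.fromSpecResidueField x := by rw [Spec.map_comp, Category.assoc]
    _ = Spec.map (φ' ≫ CommRingCat.ofHom φ₂) ≫ T.fromSpecResidueField x := by rw [hk']
    _ = Spec.map (CommRingCat.ofHom φ₂) ≫ (Spec.map φ' ≫ T.fromSpecResidueField x) := by
          rw [Spec.map_comp, Category.assoc]
    _ = Spec.map (CommRingCat.ofHom φ₂) ≫ t' := by rw [ht'x]

/-- **Independence of the geometric point from its two halves**: field-change invariance + amalgamation.
[cite: MumfordAV1970, §8 ((iv) ⇔ (i))] -/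
theorem geomPointIndependent_of (hF : ℒ.FieldChangeInvariant) (hA : GeomPointsAmalgamate T) : ℒ.GeomPointIndependent := by
  intro Ω _ _ Ω' _ _ t t' hx h
  obtain ⟨Ω'', _, _, φ₁, φ₂, e⟩ := hA Ω Ω' t t' hx
  have h'' := (hF Ω Ω'' φ₁ t).1 h
  rw [e] at h''
  exact (hF Ω' Ω'' φ₂ t').2 h''

/-- **Independence of the geometric point from field-change invariance ALONE** (amalgamation is proved above). [cite: MumfordAV1970, §8 ((iv) ⇔ (i))] -/
theorem geomPointIndependent_of_fieldChangeInvariant (hF : ℒ.FieldChangeInvariant) : ℒ.GeomPointIndependent :=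
  ℒ.geomPointIndependent_of hF (geomPointsAmalgamate T)

/-! ### §3 The head: closed + dense ⇒ all -/

/-- **THE `Pic⁰` CONDITION SPREADS ALONG A DOMINANT MAP**: let `w : T₁ → T` have DENSE image (e.g. `Spec R → Spec k[t]`
for `k[t] ⊆ R`, ★ `Limits.denseRange_specMap_of_injective`), let `ℒ` be homogeneous at every geometric point of `T` that factors through `w` (the
`FibrewisePicZero` condition of the restricted bundle `(1 × w)^*ℒ`, read through the fibre isomorphisms), and assume the
`Pic⁰` locus of `ℒ` is CLOSED and geometric points are independent (§2).  Then `ℒ` is fibrewise-`Pic⁰` over ALL of `T`: the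
locus contains the dense image, is closed, hence is everything. [cite: MumfordAV1970, §8 ((iv) ⇔ (i)), §10 (seesaw, p. 89)] [cite: MilneAV2008, I §8 pp. 36–37] -/
theorem FibrewisePicZero.of_denseRange (hind : ℒ.GeomPointIndependent) (hcl : IsClosed ℒ.picZeroLocus)
    {T₁ : Scheme.{u}} (w : T₁ ⟶ T) (hw : DenseRange w.base)
    (h₁ : ∀ (Ω : Type u) [Field Ω] [IsAlgClosed Ω] (t₁ : Spec (.of Ω) ⟶ T₁),
      IsHomogeneous ((A.baseChange f).fibre (t₁ ≫ w)).toAbelianVariety (ℒ.fibreModule (t₁ ≫ w))) :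
    ℒ.FibrewisePicZero := by
  -- the image of `w` lies in the locus
  have himage : Set.range w.base ⊆ ℒ.picZeroLocus := by
    rintro _ ⟨y, rfl⟩
    obtain ⟨t₁, ht₁⟩ := exists_geomPoint_over (T := T₁) y
    have hx : (t₁ ≫ w).base (IsLocalRing.closedPoint _) = w.base y := by
      show w.base (t₁.base (IsLocalRing.closedPoint _)) = w.base y
      exact congrArg (fun z => w.base z) ht₁
    exact hx ▸ ℒ.mem_picZeroLocus_of_isHomogeneous hind (t₁ ≫ w) (h₁ _ t₁)
  -- closed + dense ⇒ everything
  have hcl' : closure (Set.range w.base) ⊆ ℒ.picZeroLocus := closure_minimal himage hcl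
  rw [hw.closure_range] at hcl'
  exact FibrewisePicZero.of_picZeroLocus_eq_univ ℒ (Set.eq_univ_of_univ_subset hcl')

/-- **the same with the image hypothesis stated on scheme points** (`Set.range w.base ⊆ picZeroLocus ℒ`), no independence needed.
[cite: MumfordAV1970, §8 ((iv) ⇔ (i)), §10 (seesaw, p. 89)] -/
theorem FibrewisePicZero.of_denseRange_of_range_subset (hcl : IsClosed ℒ.picZeroLocus)
    {T₁ : Scheme.{u}} (w : T₁ ⟶ T) (hw : DenseRange w.base) (himage : Set.range w.base ⊆ ℒ.picZeroLocus) :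
    ℒ.FibrewisePicZero :=
  by
  have hcl' : closure (Set.range w.base) ⊆ ℒ.picZeroLocus := closure_minimal himage hcl
  rw [hw.closure_range] at hcl'
  exact FibrewisePicZero.of_picZeroLocus_eq_univ ℒ (Set.eq_univ_of_univ_subset hcl')

/-- **the head on the minimal named inputs**: field-change invariance and closedness of the locus.
[cite: MumfordAV1970, §8 ((iv) ⇔ (i)), §10 (seesaw, p. 89)] -/
theorem FibrewisePicZero.of_denseRange' (hF : ℒ.FieldChangeInvariant) (hcl : IsClosed ℒ.picZeroLocus)
    {T₁ : Scheme.{u}} (w : T₁ ⟶ T) (hw : DenseRange w.base)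
    (h₁ : ∀ (Ω : Type u) [Field Ω] [IsAlgClosed Ω] (t₁ : Spec (.of Ω) ⟶ T₁),
      IsHomogeneous ((A.baseChange f).fibre (t₁ ≫ w)).toAbelianVariety (ℒ.fibreModule (t₁ ≫ w))) :
    ℒ.FibrewisePicZero :=
  FibrewisePicZero.of_denseRange ℒ (ℒ.geomPointIndependent_of_fieldChangeInvariant hF) hcl w hw h₁

/-- **the head on the three atomic inputs**: ascent and descent of homogeneity along maps of algebraically closed fields, and
closedness of the locus.
[cite: MumfordAV1970, §8 ((iv) ⇔ (i)), §10 (seesaw, p. 89)] [cite: MilneAV2008, I §8 pp. 36–37] -/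
theorem FibrewisePicZero.of_denseRange''
    (hasc : ∀ (Ω₁ : Type u) [Field Ω₁] [IsAlgClosed Ω₁] (Ω₂ : Type u) [Field Ω₂] [IsAlgClosed Ω₂] (ψ : Ω₁ →+* Ω₂)
      (C : AbelianVariety Ω₁) (E : C.X.left.Modules), HasRank E 1 → IsHomogeneous C E →
        IsHomogeneous (C.baseChangeAlong ψ)
          ((Scheme.Modules.pullback (pullback.fst C.X.hom (Spec.map (CommRingCat.ofHom ψ)))).obj E))
    (hdesc : ∀ (Ω₁ : Type u) [Field Ω₁] [IsAlgClosed Ω₁] (Ω₂ : Type u) [Field Ω₂] [IsAlgClosed Ω₂] (ψ : Ω₁ →+* Ω₂)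
      (C : AbelianVariety Ω₁) (E : C.X.left.Modules), HasRank E 1 →
        IsHomogeneous (C.baseChangeAlong ψ)
          ((Scheme.Modules.pullback (pullback.fst C.X.hom (Spec.map (CommRingCat.ofHom ψ)))).obj E) → IsHomogeneous C E)
    (hcl : IsClosed ℒ.picZeroLocus)
    {T₁ : Scheme.{u}} (w : T₁ ⟶ T) (hw : DenseRange w.base)
    (h₁ : ∀ (Ω : Type u) [Field Ω] [IsAlgClosed Ω] (t₁ : Spec (.of Ω) ⟶ T₁),
      IsHomogeneous ((A.baseChange f).fibre (t₁ ≫ w)).toAbelianVariety (ℒ.fibreModule (t₁ ≫ w))) :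
    ℒ.FibrewisePicZero :=
  FibrewisePicZero.of_denseRange' ℒ (ℒ.fieldChangeInvariant_of_ascent_descent hasc hdesc) hcl w hw h₁

end RigidifiedLineBundle

end AbelianSchemeOver

end Literature.AlgebraicGeometry.AbelianSchemes

end
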